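import Literature.Claims.NS.Faliush2026
import Literature.Analysis.FluidPDE.TorusNSSobolevControlLifespan
import Literature.Analysis.FluidPDE.TorusNSVectorFieldGevrey
import Literature.Analysis.FunctionSpaces.TorusVectorParseval
import HarnessLib

/-!
# C141 `Faliush2026` — companion refutations of Lemma 1 (4) (p. 2 l. 41–50, `Step_L1b`) and of
# Corollary 1 (p. 3 l. 47–51, `Step_Cor1`) by the single-mode shear heat flows (records-grade
# companions to `not_Step_L1a`; typist-2 g5 kit)

**Printed statements.** Lemma 1 (4), p. 2 l. 41–50: «Moreover, `‖Δu‖²_{L²} ≤ C(D̃_σ(u) + ‖u‖²_{L²})`» for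
smooth solutions (typed `Literature.Claims.NS.Faliush2026.Step_L1b`: `∀ ν, σ > 0 ∃ C ∀` classical solutions
`∀ t`). Corollary 1, p. 3 l. 47–51: «For `σ = σ₀`, `d/dt G_{σ₀}(u) ≤ −c D̃_{σ₀}(u)`, hence `G_{σ₀}(t)` is
uniformly bounded» (typed `Step_Cor1`: `∀ ν > 0 ∃ σ₀ > 0 ∃ c > 0 ∀` classical solutions `∀ t`, derivative
within the slab).

**Countermodels.** The exact shear heat flows `U_n(t) = e^{−4π²n²νt} Re(e_{(n,0,0)} e_y)` (zero pressure,
`(U·∇)U = 0`; tree `Torus.isClassicalNSSolutionOn_expDecay_realTrigPoly_singleton`), Fourier support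
`{±(n,0,0)}`, `‖Û_n(0)(±k)‖ = ½`. With `λ_n = 4π²n²` and `x = e^{−4π²n²σ}`:
`‖ΔU_n(0)‖² = λ_n²/2`, `‖U_n(0)‖² = 1/2`, `D̃_σ(U_n(0)) = λ_n² x/2`, `G_σ(U_n(s)) = e^{−2λ_nνs}x²/2`.
(4) at `ν = σ = 1`, `t = 0` reads `λ_n² ≤ C(λ_n² e^{−4π²n²} + 1)`, false for `n > max(C,1)`
(`not_Step_L1b`); Corollary 1's inequality at `ν = 1`, `t = 0` reads `−λ_n x² ≤ −c λ_n² x/2`, i.e.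
`2π²n² c ≤ x ≤ 1`, false for `n > 1/c` (`not_Step_Cor1`). Both displays die on ONE Fourier mode of high
frequency (frequency ray), for every admissible constant.

* `not_Step_L1b : ¬ Literature.Claims.NS.Faliush2026.Step_L1b`
* `not_Step_Cor1 : ¬ Literature.Claims.NS.Faliush2026.Step_Cor1`

WHAT THIS IS NOT: not a claim about NS regularity or blow-up; not a claim about any author beyond the
typed locator.
-/

set_option linter.dupNamespace false

noncomputable section

open Set UnitAddTorus MeasureTheory
open Literature.Analysis.FunctionSpaces Literature.Analysis.FunctionSpaces.Torus
open Literature.Analysis.FluidPDE Literature.Analysis.FluidPDE.Torus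
open Literature.Claims.NS.Faliush2026

namespace Summit.NavierStokesRegularity.NavierStokesRegularity.Theorems.Faliush2026Lemma1

/-- The mode `k_n = (n, 0, 0) ∈ ℤ³`. -/
def kn (n : ℕ) : Z3 := fun i => if i = 0 then (n : ℤ) else 0

/-- The (constant) coefficient family `e_y = (0, 1, 0) ∈ ℂ³`, transversal to every `k_n`. -/
def cz : Z3 → EuclideanSpace ℂ (Fin 3) := fun _ => EuclideanSpace.single 1 1

/-- The shear profile `P_n = Re(e_{k_n} e_y)`. -/
def P (n : ℕ) : T3 → E3 := realTrigPoly {kn n} cz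

/-- The exact solution `U_n(t) = e^{−4π²|k_n|²νt} P_n`. -/
def U (ν : ℝ) (n : ℕ) : ℝ → T3 → E3 :=
  fun t x => Real.exp (-(ν * (4 * Real.pi ^ 2 * freqNormSq (kn n))) * t) • P n x

/-- kit lemma (plumbing) [folklore] -/
theorem kn_apply (n : ℕ) (i : Fin 3) : kn n i = if i = 0 then (n : ℤ) else 0 := rfl

/-- kit lemma (plumbing) [folklore] -/
theorem freqNormSq_kn (n : ℕ) : freqNormSq (kn n) = (n : ℝ) ^ 2 := by
  simp [freqNormSq, kn_apply]

/-- kit lemma (plumbing) [folklore] -/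
theorem neg_kn_ne {n : ℕ} (hn : n ≠ 0) : -kn n ≠ kn n := by
  intro h
  have h0 := congrFun h 0
  simp only [Pi.neg_apply, kn_apply, if_true] at h0
  omega

/-- kit lemma (plumbing) [folklore] -/
theorem transversal (n : ℕ) : ∑ j, (kn n j : ℂ) * cz (kn n) j = 0 := by
  simp [kn_apply, cz]

/-- kit lemma (plumbing) [folklore] -/
theorem norm_cz (n : ℕ) : ‖cz (kn n)‖ = 1 := by
  simp [cz]

/-- `U_n` solves the unforced Navier–Stokes system classically on `[0, 1]` with zero pressure. [folklore] -/
theorem isClassicalNSSolutionOn_U (ν : ℝ) (n : ℕ) :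
    Torus.IsClassicalNSSolutionOn (Icc 0 1) ν 0 (U ν n) (fun _ _ => 0) :=
  (Torus.isClassicalNSSolutionOn_expDecay_realTrigPoly_singleton ν (transversal n)).mono
    Icc_subset_Ici_self (uniqueDiffOn_Icc one_pos)

/-- kit lemma (plumbing) [folklore] -/
theorem U_zero (ν : ℝ) (n : ℕ) : U ν n 0 = P n := by
  funext x
  simp [U]

/-- Fourier support of the profile: `‖P̂_n(m)‖ = 1/2` on `{±k_n}`, `0` elsewhere. [folklore] -/
theorem norm_coeff_P {n : ℕ} (hn : n ≠ 0) (m : Z3) :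
    ‖coeff (P n) m‖ = if m = kn n ∨ m = -kn n then 1 / 2 else 0 := by
  have hne := neg_kn_ne hn
  show ‖mFourierCoeff (EuclideanSpace.complexify ∘ realTrigPoly {kn n} cz) m‖ = _
  rw [mFourierCoeff_realTrigPoly_singleton]
  by_cases h1 : m = kn n
  · have h2 : m ≠ -kn n := fun h => hne (h.symm.trans h1)
    rw [if_pos h1, if_neg h2, if_pos (Or.inl h1), EuclideanSpace.conjVec_zero, add_zero, norm_smul,
      norm_inv, Complex.norm_ofNat, norm_cz]
    norm_num
  · by_cases h2 : m = -kn n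
    · rw [if_neg h1, if_pos h2, if_pos (Or.inr h2), zero_add, norm_smul, norm_inv, Complex.norm_ofNat,
        EuclideanSpace.norm_conjVec, norm_cz]
      norm_num
    · rw [if_neg h1, if_neg h2, if_neg (not_or.2 ⟨h1, h2⟩), EuclideanSpace.conjVec_zero, add_zero,
        smul_zero, norm_zero]

/-- Weighted Plancherel sums of the profile: `Σ_m φ(m)‖P̂_n(m)‖² = φ(k_n)/2` for even weights. [folklore] -/
theorem tsum_weight {n : ℕ} (hn : n ≠ 0) (φ : Z3 → ℝ) (hφ : φ (-kn n) = φ (kn n)) :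
    ∑' m : Z3, φ m * ‖coeff (P n) m‖ ^ 2 = φ (kn n) / 2 := by
  have hne := neg_kn_ne hn
  simp_rw [norm_coeff_P hn]
  rw [tsum_eq_sum (s := ({kn n, -kn n} : Finset Z3)) fun m hm => by
    rw [Finset.mem_insert, Finset.mem_singleton, not_or] at hm
    rw [if_neg (not_or.2 ⟨hm.1, hm.2⟩)]; ring]
  rw [Finset.sum_pair hne.symm, if_pos (Or.inl rfl), if_pos (Or.inr rfl), hφ]
  ring

/-- `G_σ(U_n(s)) = e^{2as}·e^{−8π²n²σ}/2`, `a = −4π²n²ν`. [folklore] -/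
theorem Gw_U (ν σ s : ℝ) {n : ℕ} (hn : n ≠ 0) :
    Gw σ (U ν n s) = Real.exp (-(ν * (4 * Real.pi ^ 2 * freqNormSq (kn n))) * s) ^ 2 *
      (Torus.heatCoeff (2 * σ) (kn n) / 2) := by
  have hc : ∀ m : Z3, ‖coeff (U ν n s) m‖ =
      |Real.exp (-(ν * (4 * Real.pi ^ 2 * freqNormSq (kn n))) * s)| * ‖coeff (P n) m‖ :=
    fun m => norm_mFourierCoeff_complexify_const_smul _ _ _
  unfold Gw
  simp_rw [hc, mul_pow, sq_abs, mul_left_comm (Torus.heatCoeff _ _)]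
  rw [tsum_mul_left, tsum_weight hn (fun m => Torus.heatCoeff (2 * σ) m) (by
    simp only [Torus.heatCoeff_apply, freqNormSq_neg])]

/-- `D̃_σ(P_n) = (4π²n²)²·e^{−4π²n²σ}/2`. [folklore] -/
theorem Dw_P (σ : ℝ) {n : ℕ} (hn : n ≠ 0) :
    Dw σ (P n) = lapSymb (kn n) ^ 2 * Torus.heatCoeff σ (kn n) / 2 := by
  unfold Dw
  exact tsum_weight hn (fun m => lapSymb m ^ 2 * Torus.heatCoeff σ m) (by
    simp only [lapSymb, Torus.heatCoeff_apply, freqNormSq_neg])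

/-- `‖P_n‖²_{L²} = 1/2` (Parseval). [folklore] -/
theorem l2Sq_P {n : ℕ} (hn : n ≠ 0) : l2Sq (P n) = 1 / 2 := by
  unfold l2Sq P
  rw [integral_norm_sq_eq_tsum (memLp_realTrigPoly {kn n} cz 2)]
  have h := tsum_weight hn (fun _ => (1 : ℝ)) rfl
  simp only [one_mul] at h
  exact h

/-- `‖ΔP_n‖²_{L²} = (4π²n²)²/2`. [folklore] -/
theorem lapSq_P {n : ℕ} (hn : n ≠ 0) : lapSq (P n) = lapSymb (kn n) ^ 2 * (1 / 2) := by
  unfold lapSq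
  rw [← l2Sq_P hn]
  unfold l2Sq
  rw [← integral_const_mul]
  congr 1 with x
  show ‖Torus.laplacian (realTrigPoly {kn n} cz) x‖ ^ 2 = _
  rw [laplacian_realTrigPoly_singleton, norm_smul, mul_pow, Real.norm_eq_abs, sq_abs, lapSymb, neg_sq]
  rfl

/-! ## Refutation of (4) -/

/-- **Refutation of Step L1b** (`Literature.Claims.NS.Faliush2026.Step_L1b`, Lemma 1 (4), p. 2 l. 41–50,
«‖Δu‖²_{L²} ≤ C(D̃_σ(u) + ‖u‖²_{L²})» for smooth solutions): false as typed — at `ν = σ = 1`, `t = 0`, the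
shear mode of frequency `n > max(C, 1)` gives `(4π²n²)² ≤ C((4π²n²)² e^{−4π²n²} + 1)`, impossible.
[cite: Faliush2026, Lemma 1 (4) p.2 l.41–50] -/
theorem not_Step_L1b : ¬ Step_L1b := by
  intro h
  obtain ⟨C, hC⟩ := h 1 one_pos 1 one_pos
  -- the frequency `n = ⌈C⌉₊ + 1`
  set n : ℕ := ⌈C⌉₊ + 1 with hn
  have hn0 : n ≠ 0 := Nat.succ_ne_zero _
  have hnC : C < (n : ℝ) := by
    have := Nat.le_ceil C
    rw [hn]; push_cast
    linarith
  have hn1 : (1 : ℝ) ≤ n := by rw [hn]; push_cast; linarith [Nat.cast_nonneg (α := ℝ) ⌈C⌉₊]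
  have hclaim := hC 1 one_pos (U 1 n) (fun _ _ => 0) (isClassicalNSSolutionOn_U 1 n) 0
    ⟨le_rfl, zero_le_one⟩
  rw [U_zero, lapSq_P hn0, Dw_P 1 hn0, l2Sq_P hn0, lapSymb, freqNormSq_kn, Torus.heatCoeff_apply,
    freqNormSq_kn, mul_one] at hclaim
  -- abbreviations
  set L : ℝ := 4 * Real.pi ^ 2 * (n : ℝ) ^ 2 with hL
  set x : ℝ := Real.exp (-(4 * Real.pi ^ 2 * (n : ℝ) ^ 2)) with hx
  have hpi := Real.pi_gt_three
  have hLpos : 0 < L := by positivity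
  have hxpos : 0 < x := Real.exp_pos _
  -- `x · (1 + L) ≤ 1`
  have hxL : x * (1 + L) ≤ 1 := by
    have h1 : 1 + L ≤ Real.exp L := by
      have := Real.add_one_le_exp L
      linarith
    have h2 : x * Real.exp L = 1 := by
      rw [hx, hL, ← Real.exp_add]
      simp
    calc x * (1 + L) ≤ x * Real.exp L := by gcongr
      _ = 1 := h2
  -- the displayed inequality: `L²/2 ≤ C (L² x / 2 + 1/2)`
  have key : L ^ 2 * (1 / 2) ≤ C * (L ^ 2 * x / 2 + 1 / 2) := hclaim
  have hpi2 : 9 < Real.pi ^ 2 := by nlinarith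
  have hn2 : (n : ℝ) ≤ (n : ℝ) ^ 2 := by nlinarith
  have hL36 : 36 ≤ L := by rw [hL]; nlinarith
  by_cases hC0 : C ≤ 0
  · have : C * (L ^ 2 * x / 2 + 1 / 2) ≤ 0 :=
      mul_nonpos_of_nonpos_of_nonneg hC0 (by positivity)
    nlinarith
  · push Not at hC0
    -- `C x (1 + L) ≤ C`, hence `C x L ≤ C`, and `L ≥ 36 n ≥ 36 C` gives `C x ≤ 1/36 ≤ 1/2`
    have h1 : C * x * L ≤ C := by nlinarith
    have h2 : 36 * C ≤ L := by
      rw [hL]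
      have : 36 * C ≤ 36 * (n : ℝ) := by linarith
      nlinarith
    have hCx2 : C * x ≤ 1 / 2 := by
      by_contra hnot
      push Not at hnot
      -- `C ≥ C x L > L/2 ≥ 18 C`
      nlinarith
    -- from the display: `L²/2 ≤ C L² x/2 + C/2 ≤ L²/4 + C/2`, so `L² ≤ 2C`; but `L² ≥ 36·36C`
    have h3 : C * (L ^ 2 * x) ≤ L ^ 2 * (1 / 2) := by
      have := mul_le_mul_of_nonneg_left hCx2 (sq_nonneg L)
      linarith [this]
    have h4 : L ^ 2 ≤ 2 * C := by nlinarith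
    have h5 : 36 * (36 * C) ≤ L ^ 2 := by nlinarith
    nlinarith

/-! ## Refutation of Corollary 1 -/

/-- **Refutation of Step Cor1** (`Literature.Claims.NS.Faliush2026.Step_Cor1`, Corollary 1 p. 3 l. 47–51,
«d/dt G_{σ₀}(u) ≤ −c D̃_{σ₀}(u)»): false as typed — at `ν = 1`, `t = 0`, along the shear mode of frequency
`n > 1/c` the true derivative `−4π²n² x²` (`x = e^{−4π²n²σ₀}`) exceeds `−c (4π²n²)² x / 2`, since
`2π²n²c > 1 ≥ x`. [cite: Faliush2026, Corollary 1 p.3 l.47–51] -/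
theorem not_Step_Cor1 : ¬ Step_Cor1 := by
  intro h
  obtain ⟨σ₀, hσ₀, c, hc, hC⟩ := h 1 one_pos
  set n : ℕ := ⌈1 / c⌉₊ + 1 with hn
  have hn0 : n ≠ 0 := Nat.succ_ne_zero _
  have hnc : 1 / c < (n : ℝ) := by
    have := Nat.le_ceil (1 / c)
    rw [hn]; push_cast
    linarith
  have hn1 : (1 : ℝ) ≤ n := by rw [hn]; push_cast; linarith [Nat.cast_nonneg (α := ℝ) ⌈1 / c⌉₊]
  have hclaim := (hC 1 one_pos (U 1 n) (fun _ _ => 0) (isClassicalNSSolutionOn_U 1 n) 0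
    ⟨le_rfl, zero_le_one⟩).1
  -- the true derivative of `s ↦ G_{σ₀}(U(s))` at `s = 0` within `[0,1]`
  set a : ℝ := -((1 : ℝ) * (4 * Real.pi ^ 2 * freqNormSq (kn n))) with ha
  set g : ℝ := Torus.heatCoeff (2 * σ₀) (kn n) / 2 with hg
  have hfun : (fun s => Gw σ₀ (U 1 n s)) = fun s => Real.exp (a * s) ^ 2 * g := by
    funext s
    rw [Gw_U 1 σ₀ s hn0]
  have h1 : HasDerivAt (fun s : ℝ => a * s) a 0 := by
    simpa using (hasDerivAt_id (0 : ℝ)).const_mul a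
  have h4 : HasDerivAt (fun s : ℝ => Real.exp (a * s) ^ 2 * g) (2 * a * g) 0 := by
    have h3 := ((h1.exp).pow 2).mul_const g
    refine h3.congr_deriv ?_
    simp [Real.exp_zero]
  have huniq : UniqueDiffWithinAt ℝ (Icc (0 : ℝ) 1) 0 :=
    uniqueDiffOn_Icc one_pos 0 (left_mem_Icc.2 zero_le_one)
  have hderiv : derivWithin (fun s => Gw σ₀ (U 1 n s)) (Icc 0 1) 0 = 2 * a * g := by
    rw [hfun]
    exact h4.hasDerivWithinAt.derivWithin huniq
  rw [hderiv, U_zero, Dw_P σ₀ hn0, hg, ha, Torus.heatCoeff_apply, Torus.heatCoeff_apply, lapSymb,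
    freqNormSq_kn] at hclaim
  -- abbreviations: `L = 4π²n²`, `x = e^{−Lσ₀}`; `heat(2σ₀) = x²`
  set L : ℝ := 4 * Real.pi ^ 2 * (n : ℝ) ^ 2 with hL
  set x : ℝ := Real.exp (-(4 * Real.pi ^ 2 * (n : ℝ) ^ 2 * σ₀)) with hx
  have hx2 : Real.exp (-(4 * Real.pi ^ 2 * (n : ℝ) ^ 2 * (2 * σ₀))) = x ^ 2 := by
    rw [hx, ← Real.exp_nat_mul]
    congr 1
    push_cast
    ring
  rw [hx2] at hclaim
  have hpi := Real.pi_gt_three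
  have hLpos : 0 < L := by positivity
  have hxpos : 0 < x := Real.exp_pos _
  have hx1 : x ≤ 1 := by
    rw [hx]
    exact Real.exp_le_one_iff.2 (by nlinarith [hσ₀, sq_nonneg (n : ℝ)])
  -- the display: `2·(−L)·(x²/2) ≤ −c · (L² x / 2)`, i.e. `c L² x ≤ 2 L x²`, i.e. `c L ≤ 2 x ≤ 2`
  have key : 2 * -(1 * L) * (x ^ 2 / 2) ≤ -c * (L ^ 2 * x / 2) := hclaim
  have key2 : c * L ≤ 2 * x := by
    have : c * L * (L * x) ≤ 2 * x * (L * x) := by nlinarith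
    exact le_of_mul_le_mul_right this (by positivity)
  -- but `c L = 4π² c n² ≥ 4π² c n > 4π² > 2 ≥ 2x`
  have hcn : 1 < c * (n : ℝ) := by
    have := (div_lt_iff₀ hc).1 hnc
    linarith [this]
  have hpi2 : 9 < Real.pi ^ 2 := by nlinarith
  have hcnn : 1 < c * (n : ℝ) * (n : ℝ) := by nlinarith
  have hcL : 36 < c * L := by
    rw [hL]
    have : c * (4 * Real.pi ^ 2 * (n : ℝ) ^ 2) = 4 * Real.pi ^ 2 * (c * (n : ℝ) * (n : ℝ)) := by ring
    rw [this]
    nlinarith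
  linarith

end Summit.NavierStokesRegularity.NavierStokesRegularity.Theorems.Faliush2026Lemma1

end
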